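/-
Copyright (c) 2026. Released under Apache 2.0 license.
-/
import Literature.Analysis.ValidatedNumerics.MultiPrecisionInterval
import Literature.NumberTheory.LFunctions.ZetaCertifiedEvaluation
import HarnessLib

/-!
# Kernel programs for the Keiper–Li second-difference certificate

[cite: Xiao2020, Conj. 3.4; Keiper1992, §3; Li1997, Thm. 1]

S. Xiao (arXiv:2006.13103, Conj. 3.4) conjectured that the Keiper–Li coefficients are strictly
convex in the index: `λₙ > 2λₙ₋₁ − λₙ₋₂` for all `n ≥ 3`.  This file contains the *programs*
(pure integer interval arithmetic at a fixed binary scale, in the style of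
`Literature.Analysis.ValidatedNumerics.MultiPrecisionInterval`) of a kernel-checked evaluation of
the second differences `dₙ = λₙ − 2λₙ₋₁ + λₙ₋₂` for `3 ≤ n ≤ 119`; their soundness is proved in
`Xiao2020.CertSound` and the certificate is run in `Xiao2020.Certificate` (`d₁₁₉ < 0`).

Pipeline (all boxes at scale `SC = 2¹⁷⁶`):
* `uᵢ` = Taylor coefficients of `ζ₁(s) = (s−1)ζ(s)` at `s = 1`: the Euler–Maclaurin exponential
  polynomial (`N = 40`, `ν = 25`) coefficientwise (`uList`), widened by the Cauchy bound of the
  remainder on `|s − 1| = 9/10`;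
* `q_m` = Taylor coefficients of `ζ₁'/ζ₁` at `1` by the convolution recursion (`qPass`);
* `ζ(k)` (`2 ≤ k ≤ 119`) by Euler–Maclaurin with exact rational main part (`zetaBox`);
* `aₖ = (q_{k−1} + (−1)^{k−1}(1 − (1 − 2^{−k})ζ(k)))/k` = Taylor coefficients of `log ξ(1+w)`
  (`aBox`), and `dₙ = Σₖ k (C(n,k) − 2C(n−1,k) + C(n−2,k)) aₖ` (`dSeq`).

No `Nat.choose`, Bernoulli recursion, factorial table or long exact rational sum is evaluated naively: binomial rows are
built by Pascal's rule, Pochhammer coefficient rows by their two-term recursion, and the Bernoulli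
data is `ZetaNumerics.emCoeffList` (memoised).
-/

namespace Literature.NumberTheory.LFunctions.Xiao2020

open Literature.Analysis.ValidatedNumerics Literature.Analysis.ValidatedNumerics.NumericsMP

namespace CertKernel

/-! ## Generic list programs over boxes -/

/-- The zero box. [folklore] -/
def zeroI : MI := ⟨0, 0⟩

/-- `trowFrom S X cur j c = [cur, cur·X/(j+1), cur·X²/((j+1)(j+2)), …]` (`c` entries): encloses
`x^{j+i}/(j+i)!` when `cur ∋ xʲ/j!` and `X ∋ x`. [folklore] -/
def trowFrom (S : ℕ) (X : MI) : MI → ℕ → ℕ → List MI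
  | _, _, 0 => []
  | cur, j, c + 1 => cur :: trowFrom S X ((cur.mul S X).divNat (j + 1)) (j + 1) c

/-- `[1, x, x²/2!, …]` (`len` entries) for `x ∈ X`. [folklore] -/
def trow (S : ℕ) (X : MI) (len : ℕ) : List MI := trowFrom S X (MI.ofInt S 1) 0 len

/-- Entrywise sum, truncated to the shorter list. [folklore] -/
def addL (L M : List MI) : List MI := List.zipWith MI.add L M

/-- Dot product `Σ Gₗ·Tₗ` over the common prefix. [folklore] -/
def dot (S : ℕ) : List MI → List MI → MI
  | g :: G, t :: T => (g.mul S t).add (dot S G T)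
  | _, _ => zeroI

/-- Integer-weighted dot product `Σ eₖ·Aₖ` over the common prefix. [folklore] -/
def dotZ : List ℤ → List MI → MI
  | e :: E, A :: As => (A.mulInt e).add (dotZ E As)
  | _, _ => zeroI

/-- `dPass S G ts trev`: walking along `ts = [tᵢ, tᵢ₊₁, …]` with `trev = [tᵢ₋₁, …, t₀]`, emit
`dot G trev` at each position, i.e. entry `i ↦ Σₗ Gₗ · tᵢ₋₁₋ₗ` (a shifted convolution).
[folklore] -/
def dPass (S : ℕ) (G : List MI) : List MI → List MI → List MI
  | [], _ => []
  | t :: ts, trev => dot S G trev :: dPass S G ts (t :: trev)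

/-- `tabulate F k c = [F k, F (k+1), …, F (k+c-1)]`. [folklore] -/
def tabulate (F : ℕ → MI) : ℕ → ℕ → List MI
  | _, 0 => []
  | k, c + 1 => F k :: tabulate F (k + 1) c

/-- The box of a rational number. [folklore] -/
def ratBox (S : ℕ) (q : ℚ) : MI := MI.ofFrac S q.num q.den

/-- An integer `≥ q · S`. [folklore] -/
def ceilScaled (S : ℕ) (q : ℚ) : ℤ := Numerics.cdiv (q.num * S) q.den

/-- Box `[⌊pS/q⌋, ⌊pS/q⌋ + 1]` of `p/q` for naturals `p` and `q > 0` (natural-number division only: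
this is markedly faster in the kernel than `MI.ofFrac` when `p ≪ q`). [folklore] -/
def fracBox (S p q : ℕ) : MI := ⟨((p * S / q : ℕ) : ℤ), ((p * S / q : ℕ) : ℤ) + 1⟩

/-- Box of `p/q` for an integer `p` and `q > 0`, by sign. [folklore] -/
def zfracBox (S : ℕ) (p : ℤ) (q : ℕ) : MI :=
  if 0 ≤ p then fracBox S p.toNat q else (fracBox S (-p).toNat q).neg

/-! ## Logarithm tables and the Euler–Maclaurin exponential polynomial, coefficientwise -/

/-- Enclosures of `log 1, …, log n`. [folklore] -/
def logsList (S K : ℕ) : ℕ → Option (List MI)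
  | 0 => some []
  | n + 1 =>
    match logsList S K n, MI.logNat S K (n + 1) with
    | some L, some y => some (L ++ [y])
    | _, _ => none

/-- The `Σₙ n^{-(1+w)}` part, coefficientwise: starting from `acc`, add for each log-box `L ∋ log n`
(consecutive `n` from the given one) the list `i ↦ [1 ≤ i] (−log n)^{i−1}/((i−1)! n)`. [folklore] -/
def aPass (S len : ℕ) : List MI → ℕ → List MI → List MI
  | [], _, acc => acc
  | L :: Ls, n, acc =>
      aPass S len Ls (n + 1) (addL acc (zeroI :: (trow S L.neg len).map fun t ↦ t.divNat n))

/-- Row `m` of the Pochhammer coefficients: `X(X+1)⋯(X+m−1) = Σₗ pc(m,l) Xˡ`, by the recursion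
`pc(m+1,l) = (m+1)·pc(m,l) + pc(m,l−1)` (matches `Xiao2020.pochCoeff`). [folklore] -/
def pochRow : ℕ → List ℕ
  | 0 => [1]
  | m + 1 => List.zipWith (fun a b ↦ (m + 1) * a + b) (pochRow m ++ [0]) (0 :: pochRow m)

/-- The rows `pc(2k−1, ·)`, `k = 1, …, ν` (built once). [folklore] -/
def pochRows (ν : ℕ) : List (List ℕ) := (List.range ν).map fun j ↦ pochRow (2 * (j + 1) - 1)

/-- `gₗ = Σ_{k=1}^{ν} c_k N^{−2k} pc(2k−1, l)` with `c_k = B_{2k}/(2k)!` read off the list `cs` and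
the Pochhammer rows read off `PR`. [folklore] -/
def gCoeffQ (cs : List ℚ) (PR : List (List ℕ)) (N ν l : ℕ) : ℚ :=
  ∑ j ∈ Finset.range ν,
    cs.getD (j + 1) 0 / (N : ℚ) ^ (2 * (j + 1)) * (((PR.getD j []).getD l 0 : ℕ) : ℚ)

/-- The boxes of `g₀, …, g_{2ν−1}`. [folklore] -/
def gList (S : ℕ) (cs : List ℚ) (N ν : ℕ) : List MI :=
  let PR := pochRows ν
  (List.range (2 * ν)).map fun l ↦ ratBox S (gCoeffQ cs PR N ν l)

/-- The Cauchy majorant `r·B(N,ν,r)` data: `B = Π_{j ≤ 2ν}(1+j+r) · (33/10)(25/157)^{2ν+1} /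
(N^{2ν} · 2ν)` as an exact rational (cast = `Xiao2020.emTailBound`). [folklore] -/
def tailBoundQ (N ν : ℕ) (r : ℚ) : ℚ :=
  (∏ j ∈ Finset.range (2 * ν + 1), (1 + j + r)) * ((33 / 10 : ℚ) * (25 / 157) ^ (2 * ν + 1)) *
    (1 / ((N : ℚ) ^ (2 * ν) * (2 * ν)))

/-- Widen the `i`-th box by `⌈eᵢ S⌉`, `e₀ = e`, `eᵢ₊₁ = eᵢ · rinv`. [folklore] -/
def widenPass (S : ℕ) : List MI → ℚ → ℚ → List MI
  | [], _, _ => []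
  | P :: Ps, e, rinv => P.widen (ceilScaled S e) :: widenPass S Ps (e * rinv) rinv

/-! ## `ζ(k)` at integers `k ≥ 2` -/

/-- Boxes of the partial sums `Σ_{m<M} (m+1)^{−k}`. [folklore] -/
def invPowSum (S k : ℕ) : ℕ → MI
  | 0 => zeroI
  | M + 1 => (invPowSum S k M).add (fracBox S 1 ((M + 1) ^ k))

/-- `bernPass S N k cs j pk pw acc = acc + Σ_{j' ≥ j}` boxes of the Bernoulli correction terms
`c_{j'+1} · k(k+1)⋯(k+2j') / N^{k+2j'+1}` of Euler–Maclaurin for `ζ(k)`, one for each entry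
`c_{j'+1}` of `cs`; `pk = k(k+1)⋯(k+2j)` and `pw = N^{k+2j+1}` are carried along. [folklore] -/
def bernPass (S N k : ℕ) : List ℚ → ℕ → ℕ → ℕ → MI → MI
  | [], _, _, _, acc => acc
  | c :: cs, j, pk, pw, acc =>
      bernPass S N k cs (j + 1) (pk * ((k + 2 * j + 1) * (k + 2 * j + 2))) (pw * N ^ 2)
        (acc.add (zfracBox S (c.num * pk) (c.den * pw)))

/-- Box of `Σ_{j<ν}` of the Bernoulli correction terms (`cs = [c₀, c₁, …]`). [folklore] -/
def bernTermSum (S : ℕ) (cs : List ℚ) (N ν k : ℕ) : MI :=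
  bernPass S N k ((cs.drop 1).take ν) 0 k (N ^ (k + 1)) zeroI

/-- The Euler–Maclaurin remainder bound for `ζ(k)` (= `Xiao2020.zetaNatTail`). [folklore] -/
def zetaNatTailK (N ν k : ℕ) : ℚ :=
  ((∏ i ∈ Finset.range (2 * ν + 1), (k + i) : ℕ) : ℚ) * ((33 / 10 : ℚ) * (25 / 157) ^ (2 * ν + 1)) *
    (1 / ((N : ℚ) ^ (k + 2 * ν) * ((k : ℚ) + 2 * ν)))

/-- Box of `ζ(k)` (`k ≥ 2`): the Euler–Maclaurin main part `Σ_{m<N−1}(m+1)^{−k} + N^{1−k}/(k−1) +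
N^{−k}/2 + Σ_{j<ν} (Bernoulli terms)` termwise, widened by the remainder bound. [folklore] -/
def zetaBox (S : ℕ) (cs : List ℚ) (N ν k : ℕ) : MI :=
  ((((invPowSum S k (N - 1)).add (ratBox S ((N : ℚ) / ((N : ℚ) ^ k * ((k : ℚ) - 1))))).add
      (ratBox S (1 / (2 * (N : ℚ) ^ k)))).add (bernTermSum S cs N ν k)).widen
    (ceilScaled S (zetaNatTailK N ν k))

/-! ## The Taylor coefficients of `ζ₁'/ζ₁` and of `log ξ` at `1`, and the second differences -/

/-- `qPass S us rest m qrev c`: with `us = [U₁, U₂, …]`, `rest = [U_{m+1}, …]` and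
`qrev = [Q_{m−1}, …, Q₀]`, push `Q_m = (m+1)U_{m+1} − Σ_{i=1}^{m} Uᵢ Q_{m−i}` and continue (`c`
steps); returns the final reversed list. [folklore] -/
def qPass (S : ℕ) (us : List MI) : List MI → ℕ → List MI → ℕ → List MI
  | _, _, qrev, 0 => qrev
  | [], _, qrev, _ + 1 => qrev
  | u :: rest, m, qrev, c + 1 =>
      qPass S us rest (m + 1) (((u.mulInt ((m : ℤ) + 1)).sub (dot S us qrev)) :: qrev) c

/-- Box of `Re aₖ = (Re q_{k−1} + (−1)^{k−1}(1 − (1−2^{−k}) ζ(k)))/k` for `k ≥ 2` (zero box for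
`k < 2`), given the list `Q = [Q₀, Q₁, …]`. [folklore] -/
def aBox (S : ℕ) (cs : List ℚ) (N ν : ℕ) (Q : List MI) (k : ℕ) : MI :=
  if k < 2 then zeroI else
    let Z := zetaBox S cs N ν k
    let T := Z.sub (Z.divNat (2 ^ k))
    let V := (MI.ofInt S 1).sub T
    let W := if k % 2 = 1 then V else V.neg
    ((Q.getD (k - 1) zeroI).add W).divNat k

/-- Pascal's rule on a zero-padded row: `C(n+1,k) = C(n,k) + C(n,k−1)`. [folklore] -/
def pascalNext (R : List ℕ) : List ℕ := List.zipWith (· + ·) R (0 :: R)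

/-- The weights `k ↦ k·(C(n,k) − 2C(n−1,k) + C(n−2,k))` from the rows of `n, n−1, n−2`.
[folklore] -/
def erow (len : ℕ) (R2 R1 R0 : List ℕ) : List ℤ :=
  List.zipWith (fun (k : ℕ) (v : ℤ) ↦ (k : ℤ) * v) (List.range len)
    (List.zipWith (fun (s : ℤ) (c : ℕ) ↦ s + c)
      (List.zipWith (fun (a b : ℕ) ↦ (a : ℤ) - 2 * b) R2 R1) R0)

/-- Boxes of `dₙ` for `c` consecutive `n`, given the rows of `n−2, n−1, n` for the first one and
the list `A` of boxes of `Re aₖ`. [folklore] -/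
def dSeq (len : ℕ) (A : List MI) : List ℕ → List ℕ → List ℕ → ℕ → List MI
  | _, _, _, 0 => []
  | R0, R1, R2, c + 1 => dotZ (erow len R2 R1 R0) A :: dSeq len A R1 R2 (pascalNext R2) c

/-- The final sign check on `[d₃, d₄, …]`: `dₙ.lo > 0` for `n < nNeg` and `d_{nNeg}.hi < 0`.
[folklore] -/
def checkD (nNeg : ℕ) : List MI → ℕ → Bool
  | [], _ => false
  | D :: Ds, n => if n < nNeg then decide (0 < D.lo) && checkD nNeg Ds (n + 1) else decide (D.hi < 0)

/-! ## Parameters and the assembled programs -/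

/-- Scale `2¹⁷⁶`. [folklore] -/
def SC : ℕ := 2 ^ 176
/-- Terms of the logarithm series. [folklore] -/
def KLOG : ℕ := 180
/-- Euler–Maclaurin cut-off. [folklore] -/
def N : ℕ := 40
/-- Euler–Maclaurin order. [folklore] -/
def NU : ℕ := 25
/-- Largest Taylor index / largest `n`. [folklore] -/
def IMAX : ℕ := 119
/-- Cauchy radius `r = 9/10`. [folklore] -/
def rQ : ℚ := 9 / 10
/-- The index of the certified failure. [folklore] -/
def NNEG : ℕ := 119

/-- Boxes `[P₀, …, P_IMAX]` of the coefficients of the Euler–Maclaurin exponential polynomial of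
`ζ₁(1+w)`, then widened to boxes `[U₀, …, U_IMAX]` of the Taylor coefficients `uᵢ` of `ζ₁` at `1`.
[folklore] -/
def uList : Option (List MI) :=
  match logsList SC KLOG (N - 1), MI.logNat SC KLOG N with
  | some Ls, some LN =>
      let A := aPass SC IMAX Ls 1 (List.replicate (IMAX + 1) zeroI)
      let rowN := trow SC LN.neg (IMAX + 1)
      let C := zeroI :: rowN.map fun t ↦ t.divNat (2 * N)
      let D := dPass SC (gList SC (ZetaNumerics.emCoeffList NU) N NU) rowN []
      some (widenPass SC (addL (addL (addL A rowN) C) D) (rQ * tailBoundQ N NU rQ) rQ⁻¹)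
  | _, _ => none

/-- Boxes `[Q₀, …, Q_{IMAX−1}]` of `Re q_m`, from `U`. [folklore] -/
def qList (U : List MI) : List MI := (qPass SC U.tail U.tail 0 [] IMAX).reverse

/-- Boxes `[A₀, …, A_IMAX]` (`A₀ = A₁ = 0`) of `Re aₖ`, from `Q`. [folklore] -/
def aList (Q : List MI) : List MI :=
  tabulate (aBox SC (ZetaNumerics.emCoeffList NU) N NU Q) 0 (IMAX + 1)

/-- Boxes `[d₂, d₃, …, d_IMAX]`, from `A`. [folklore] -/
def dList (A : List MI) : List MI :=
  let row0 : List ℕ := 1 :: List.replicate IMAX 0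
  let row1 := pascalNext row0
  dSeq (IMAX + 1) A row0 row1 (pascalNext row1) (IMAX - 1)

/-- **The certificate**: `dₙ > 0` for `3 ≤ n ≤ 118` and `d₁₁₉ < 0`. [folklore] -/
def cert : Bool :=
  match uList with
  | none => false
  | some U => checkD NNEG (dList (aList (qList U))).tail 3

end CertKernel

end Literature.NumberTheory.LFunctions.Xiao2020
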